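import Summits.QuantumFields.YangMills.Theorems.BalabanUVNodesN22AtGeneratedHistory13CoPH

/-!
# A6 WITNESSES FOR THIS LINEAGE's N18 → N22 KNITS, PART 1 — the θ-form binder lists are JOINTLY INHABITED at every Stage-13 tuple
# (STANDING A6 RULE, director-ym LINE №189 (3), pub-ymgap INBOX l.20645; LINE №193 (4), l.21633: «run the same probe … on n22-e's home files»)

WHY THIS FILE EXISTS.  №189 (3): «every junction ∕ knit lemma whose hypotheses are member-local binders ships IN THE SAME FILE a satisfiability witness — `example : ∃ …,
<the binders>` or a named inhabitant at the record's data — or says in its docstring why the binders are inhabited by a cited tree term; referees grade a knit without it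
A6-UNCHECKED».  This seat's KNIT modules 7″ ∕ 8a″ ∕ 8c″ (the N18 → N22 edges at W1 readings — analytic ∕ strip ∕ sharp-schema packages) and the slot faces of 9″a ∕ 9″b ∕ 9″c ∕ 6″,
in all six Record-13 editions (`…13`, `…13Sep`, `…13Co`, `…13CoP`, `…13CoPR`, `…13CoPH`; the v1.6 ∕ v1.7 ones were filed AFTER the rule), carried PARTIAL witnesses by decl only
(8c₁₂ §Nonvacuity `genSchemas_nonvacuous` = the schema package ALONE; 9″c §4 `s_N22_rRec₁₃CoPH_w1_of_EA_zero`; W1 RR-1 §6 `exists_assignmentInputs₁₂_populated_functionals_zero`).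
This module (Part 1) and `BalabanUVNodesN22SlotBindersInhabited` (Part 2) supply the missing shape: for each θ-form knit LEMMA — of which every stub-level knit theorem of the
nine homes, in every edition, is the pointwise application — ONE theorem `…_binders_inhabited : ∀ θ, ∃ ⟨objects⟩, ⟨EVERY binder, jointly⟩` (Part 2's slot witnesses
ask `0 < θ.γ`, which the analytic block's signs need), kernel-checked.

THE WITNESS (one for all; DEGENERATE BY DESIGN, and said to be so).  W1's TERMLESS GENERATORS (no indices at any step: every (2.11) sum is empty, every generated (2.13) term is `0` — the device of 8c₁₂ §Nonvacuity
and of RR-1 §6) on every torus; the admissible reading of record `ReadingData.ofRecordAdm` on their run towers with space tables `univ`, gauge `0`, transport to the trivial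
field; letter inputs `κ = C₅ = cr = 0`, `θ₅ = s = ½`, `C₀ = A = μ = r = 1`, `ρ = (½)^{½}` (§1 `exists_letterInputs_numerals_signs`: the eleven numerals, the strip road's `1 ≤ μ`,
the analytic block's SIGNS at any radius `γ > 0`, the rate pin `θ₅ ≤ ω`, `0 < ω`).  Then EVERY level functional `EA k`, `EB k b` VANISHES (§1), so `N18At` holds at every
bundle with no estimate (§2 — the N18 twin of 9‴c §4 «INHABITATION IS NOT CONTENT»), the schema ∕ analytic packages hold with `Dk := univ`, `Adm := univ`, extension
`Fz := 0`, and the numerals hold by arithmetic.  The edge lemmas' last binder `0 < θ.γ` is a property of the TUPLE (at a datum of record: `….gamma_pos`), not of the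
objects; Part 1's witnesses hold at EVERY tuple, with no hypothesis.

A6 INDEX, PART 1 (stub-level knit theorems ↦ θ-form lemma ↦ witness; «ed.» = the same-named twin in each of the six editions):
* 8c″ `…N22AtGeneratedHistory13CoPH` — `s_N22_rRec₁₃CoPH(On)_w1_gen_of_s_N18_schemasBelow`, `s_N22_readingOfRecord₁₃CoPH(On)(_ofRecordGen)_gen_of_s_N18_schemasBelow`,
  `n22_tupleReadingOfRecordCoPH(On)_gen_of_n18Below_schemasBelow` (8 thm), ed. ↦ 8c‴ §1 `n22At_u3OfRecord₁₃_ofRecordAdm_gen_of_n18Below_schemasBelow`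
  ↦ §3 `ofRecordAdm_gen_schemasBelow_binders_inhabited` (`N18At` at EVERY run length ∧ the sharp package ∧ the numerals, at every run length).
* 8a″ `…N22EdgeAtW1AdmReadingOfRecord13CoPH` (3 thm), ed. ↦ 8a‴ §1 `n22At_u3OfRecord₁₃_ofRecordAdm_of_n18Below_analytic` ↦ §3 `ofRecordAdm_analytic_binders_inhabited`.
* 7″ `…N22EdgeAtW1Reading13CoPH` (6 thm; its strip-currency theorems read dag-n22-c's `n22At_u3OfRecord₁₂_w1Reading_of_n18Below_stripBound`, whose `hstrip` is the letter
  (A) with `Ec := 0`, `O := univ` at the same witness and whose twelfth numeral `1 ≤ μ` is in §1), ed. ↦ 7‴ §2 `n22At_u3OfRecord₁₃_w1_of_n18Below_analytic`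
  ↦ §3 `w1_analytic_binders_inhabited` (pairing coherence BY NAME: dag-n22-c's `pairingCoherence_ofRecordAdm`).
* Part 2: the slots (A) ∕ (A′) ∕ (R₂) of 9″a, the «`FadingMemory` by name» faces of 9″b ∕ 9″c ∕ 6″, and two CoPH stub-level binder lists WITH `S_N18 (RRec₁₃CoPH …)` as a conjunct.
* NOT knits (definitional `↔` ∕ transport faces — A6 moot): 1″ ∕ 5″ ∕ 6″ ∕ 9″a's `…_iff`, `…_of_ne9`, `…_of_forall_admissible`, `…_of_pin`, `…_iff_of_u3_agree`, `spineRates_…`;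
  the homes' OWN inhabitation is in-file (1″ §4 `s_R00x_rRec₁₃CoPH` — existence free, objects residual; honesty `k4_rRec₁₃CoPH_of_uninhabited`).

HONEST FRAMING.  A6 bookkeeping with a DEGENERATE inhabitant: INHABITATION IS NOT CONTENT — the witnesses are termless towers, at which N18 ∕ N22 hold with nothing
proved (so the knits are NOT vacuous, and NOT thereby substantive); a discharge keyed to a W1
reading NAMES its generators and owes their identification with the construction's (2.14) terms (N10's ∕ W1's object).  In particular the sharp package's UNIFORM `li.r`-discs
about `]0, θ.γ]` are satisfiable here but are NOT the print's road at the datum (dag-n22-c g6 F3: threshold-flat terms ⇒ relative sectors; the live road is dag-n22-c's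
`…N22W1RelCentred…` series over 6″'s `↔` faces).  Nothing of Bałaban's is asserted or instantiated; NE5 ∕ NE9 NOT PRINTED for d = 4 and NOT PROVED; no inhabitant of
`IsDatumOfRecord₁₃CCoPH` claimed (K0 OPEN); N22 NOT discharged; counts UNMOVED (typed 28∕28 · discharged 5∕27); one finite four-torus programme at fixed `ε` — NOT ℝ⁴, NOT OS,
NOT a mass gap, NOT Clay.  Filed `--kind proof --supports stmt-QuantumFields-20544 --as helper` (K3⁷, dag-lead WORDS-143); COUNT-NEUTRAL.  0 `def`, 0 `sorry`; no decl
carries a cite tag ([folklore] bookkeeping).  Cell `pub-ymgap` (D-0062, Track A), seat `pub-ymgap-dag-n22-e` gen 15.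
-/

noncomputable section

namespace YMDAG.N22

open Set Metric ComplexConjugate
open scoped BigOperators
open Literature.MathematicalPhysics.QuantumFieldTheory.Balaban1983to89
open Literature.MathematicalPhysics.QuantumFieldTheory.Balaban1983to89.T4Continuum
open Literature.MathematicalPhysics.QuantumFieldTheory.Balaban1983to89.T4OutputRate
open Literature.MathematicalPhysics.QuantumFieldTheory.Balaban1983to89.Node00
  (Stage13Params Stage13HParams NE2Objects₁₁ NE3Letters₁₁ MatA ιSU)
open Literature.MathematicalPhysics.QuantumFieldTheory.Balaban1983to89.Node00.Sect2 (domSys CPair ofBackgroundC)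
open Literature.MathematicalPhysics.QuantumFieldTheory.Balaban1983to89.Node00.W1
open YMDAG.UVSplit

variable {N : ℕ} [NeZero N]

/-! ## §1 Termless generators: every generated term vanishes, hence every level functional of the admissible reading on their run towers -/

section Termless

variable {P : Params} {𝔸 : Type*} {M : ℕ}

omit [NeZero N] in
open Classical in
/-- **A TERMLESS GENERATOR EXISTS ON EVERY TORUS** (no indices at any step, so every (2.11) sum is empty and every generated (2.13) term is `0`) — the witness of
8c₁₂'s `genSchemas_nonvacuous`, exported with the one property the A6 witnesses below read: `recTerm G g j X φ = 0` for every complex history, level, domain and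
configuration.  INHABITATION IS NOT CONTENT: this is NOT NODE 00's generator. [folklore] -/
theorem exists_genTower_recTerm_eq_zero (P : Params) (𝔸 : Type*) (M : ℕ) :
    ∃ G : GenTower P 𝔸 M,
      (∀ (m : ℕ) (t : ℂ) (old : OlderTerms P 𝔸 M m) (φ : CPair P 𝔸) (X : (domSys P M (m + 1)).Dom), (G m).E t old φ X = 0) ∧
      ∀ (g : ℕ → ℂ) (j : ℕ) (X : (domSys P M j).Dom) (φ : CPair P 𝔸), recTerm G g j X φ = 0 := by
  let G : GenTower P 𝔸 M := fun m => ⟨PEmpty, fun _ => ∅, fun i => nomatch i⟩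
  have hE : ∀ (m : ℕ) (t : ℂ) (old : OlderTerms P 𝔸 M m) (φ : CPair P 𝔸) (X : (domSys P M (m + 1)).Dom), (G m).E t old φ X = 0 := by
    intro m t old φ X
    have h1 : (G m).E t old φ X = (termlessTower P 𝔸 M m).E (fun _ => 0) φ X := by
      unfold StepGen.E ClusterStep.E
      congr 1
    rw [h1]
    exact E_termlessTower m _ φ X
  refine ⟨G, hE, fun g j X φ => ?_⟩
  cases j with
  | zero => exact recTerm_zero G g X φ
  | succ m => rw [recTerm_succ]; exact hE m _ _ φ X

omit [NeZero N] in
/-- **LETTER INPUTS CARRYING EVERY NUMERAL THE KNITS ASK** at a window radius `γ > 0`: the eleven numerals of the N18 → N22 edges (`0 < C₀`, `0 < θ₅ < 1`, `0 ≤ C₅`,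
`2C₅∕(1−θ₅) ≤ C₀`, `0 < A`, `θ₅ ≤ μ`, `C₀ ≤ 2A`, `0 < r`, `0 < s < 1`), the strip road's twelfth (`1 ≤ μ`), the displayed SIGNS of the analytic block at radius `γ`, and the
second-difference slot's rate pin `θ₅ ≤ ω` — witnessed by `κ = C₅ = cr = 0`, `θ₅ = s = ½`, `C₀ = A = μ = r = 1`, `ρ = ω = (½)^{½}`.  Plumbing only. [folklore] -/
theorem exists_letterInputs_numerals_signs {γ : ℝ} (hγ : 0 < γ) :
    ∃ li : LetterInputs,
      (0 < li.C₀ ∧ 0 < li.θ₅ ∧ li.θ₅ < 1 ∧ 0 ≤ li.C₅ ∧ 2 * li.C₅ / (1 - li.θ₅) ≤ li.C₀ ∧ 0 < li.A ∧ li.θ₅ ≤ li.μ ∧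
        li.C₀ ≤ 2 * li.A ∧ 0 < li.r ∧ 0 < li.s ∧ li.s < 1) ∧
      1 ≤ li.μ ∧ (li.analytic γ).Signs ∧ li.θ₅ ≤ (li.analytic γ).ω ∧ 0 < (li.analytic γ).ω := by
  have hω : (1 / 2 : ℝ) ^ (1 - 1 / 2 : ℝ) * (1 : ℝ) ^ (1 / 2 : ℝ) = (1 / 2 : ℝ) ^ (1 / 2 : ℝ) := by
    rw [Real.one_rpow, mul_one]; norm_num
  have hω1 : (1 / 2 : ℝ) ^ (1 / 2 : ℝ) < 1 := Real.rpow_lt_one (by norm_num) (by norm_num) (by norm_num)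
  have hθω : (1 / 2 : ℝ) ≤ (1 / 2 : ℝ) ^ (1 / 2 : ℝ) := by
    conv_lhs => rw [← Real.rpow_one (1 / 2 : ℝ)]
    exact Real.rpow_le_rpow_of_exponent_ge (by norm_num) (by norm_num) (by norm_num)
  refine ⟨⟨0, 1 / 2, 0, 0, (1 / 2 : ℝ) ^ (1 / 2 : ℝ), 1, 1, 1, 1, 1 / 2⟩, ?_, le_rfl, ?_, ?_, ?_⟩
  · refine ⟨one_pos, by norm_num, by norm_num, le_rfl, by norm_num, one_pos, by norm_num, by norm_num, one_pos, by norm_num, by norm_num⟩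
  · refine LetterInputs.signs_analytic _ γ le_rfl (by norm_num) (by norm_num) le_rfl ?_ ?_ ?_ le_rfl ?_ ?_ ?_
    · have hmin : 0 < min ((1 : ℝ) / 2) (γ / 2) := lt_min (by norm_num) (by linarith)
      positivity
    · positivity
    · show (1 / 2 : ℝ) ^ (1 - 1 / 2 : ℝ) * (1 : ℝ) ^ (1 / 2 : ℝ) < 1
      rw [hω]; exact hω1
    · exact hθω
    · show (1 / 2 : ℝ) ^ (1 - 1 / 2 : ℝ) * (1 : ℝ) ^ (1 / 2 : ℝ) ≤ (1 / 2 : ℝ) ^ (1 / 2 : ℝ)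
      rw [hω]
    · exact hω1
  · show (1 / 2 : ℝ) ≤ (1 / 2 : ℝ) ^ (1 - 1 / 2 : ℝ) * (1 : ℝ) ^ (1 / 2 : ℝ)
    rw [hω]; exact hθω
  · show (0 : ℝ) < (1 / 2 : ℝ) ^ (1 - 1 / 2 : ℝ) * (1 : ℝ) ^ (1 / 2 : ℝ)
    rw [hω]; positivity

omit [NeZero N] in
/-- The run tower of a generator all of whose terms vanish has vanishing (2.13) functional (every run length, history, configuration, domain). [folklore] -/
theorem functionalC_runTowers_toClusterTower_eq_zero {F : T4Family} (G : (k : ℕ) → GenTower (F.P k) 𝔸 M)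
    (hG : ∀ (k : ℕ) (g : ℕ → ℂ) (j : ℕ) (X : (domSys (F.P k) M j).Dom) (φ : CPair (F.P k) 𝔸), recTerm (G k) g j X φ = 0)
    (k : ℕ) (g : ℕ → ℝ) (φ : CPair (F.P k) 𝔸) (X : Node00.W1.Dom (F.P k) M) :
    functionalC (runTowers (fun k => toClusterTower (G k)) k) g φ X = 0 := by
  have h0 : TermlessBeyond (toClusterTower (G k)) 0 := fun j Y g ψ _ => by
    rw [termC_toClusterTower]
    exact hG k _ j Y ψ
  show termC (truncRun k (toClusterTower (G k))) X.1 X.2 g φ = 0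
  rw [(h0.mono (Nat.zero_le k)).termC_truncRun_eq, termC_toClusterTower]
  exact hG k _ X.1 X.2 φ

end Termless

section TermlessReading

variable {F : T4Family} {M : ℕ} (G : (k : ℕ) → GenTower (F.P k) (MatA N) M)
  (sp : (k j : ℕ) → (domSys (F.P k) M j).Dom → Set (CPair (F.P k) (MatA N)))
  (gauge : (k : ℕ) → GaugeField (F.P k) 0 (Node00.SU N) → GaugeField (F.P k) 0 (Node00.SU N) → ℝ) (hg : ∀ k U U', 0 ≤ gauge k U U')
  (T₀ : (k : ℕ) → GaugeField (F.P (k + 1)) 0 (Node00.SU N) → GaugeField (F.P k) 0 (Node00.SU N))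
  (hT₀ : ∀ (k : ℕ) (U : GaugeField (F.P (k + 1)) 0 (Node00.SU N)),
    (∀ (j : ℕ) (Y : (domSys (F.P (k + 1)) M j).Dom), ofBackgroundC (ιSU N) U ∈ sp (k + 1) j Y) →
    ∀ (j : ℕ) (Y : (domSys (F.P k) M j).Dom), ofBackgroundC (ιSU N) (T₀ k U) ∈ sp k j Y)
  (li : LetterInputs) (γ : ℝ)

omit [NeZero N] in
/-- **RUN A's LEVEL FUNCTIONALS OF THE ADMISSIBLE READING ON TERMLESS GENERATED RUN TOWERS VANISH** (any tables, gauge, transport, letters, radius). [folklore] -/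
theorem u3Objects_ofRecordAdm_EA_eq_zero_of_recTerm
    (hG : ∀ (k : ℕ) (g : ℕ → ℂ) (j : ℕ) (X : (domSys (F.P k) M j).Dom) (φ : CPair (F.P k) (MatA N)), recTerm (G k) g j X φ = 0)
    (k : ℕ) (g : ℕ → ℝ) (U : AdmBg F M N sp k) (X : Node00.W1.Dom (F.P k) M) :
    ((ReadingData.ofRecordAdm F M N (runTowers fun k => toClusterTower (G k)) sp gauge hg T₀ hT₀ li).u3Objects γ).EA k g U X = 0 := by
  show (functionalC (runTowers (fun k => toClusterTower (G k)) k) g (ofBackgroundC (ιSU N) U.1) X).re = 0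
  rw [functionalC_runTowers_toClusterTower_eq_zero G hG]
  simp

omit [NeZero N] in
/-- **… AND SO DO RUN B's FIRST-COUPLING FAMILIES.** [folklore] -/
theorem u3Objects_ofRecordAdm_EB_eq_zero_of_recTerm
    (hG : ∀ (k : ℕ) (g : ℕ → ℂ) (j : ℕ) (X : (domSys (F.P k) M j).Dom) (φ : CPair (F.P k) (MatA N)), recTerm (G k) g j X φ = 0)
    (k : ℕ) (b : ℝ) (g : ℕ → ℝ) (U : AdmBg F M N sp (k + 1)) (X : Node00.W1.Dom (F.P k) M) :
    ((ReadingData.ofRecordAdm F M N (runTowers fun k => toClusterTower (G k)) sp gauge hg T₀ hT₀ li).u3Objects γ).EB k b g U X = 0 := by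
  show (functionalC (runTowers (fun k => toClusterTower (G k)) (k + 1)) (Node00.prependCoupling b g) (ofBackgroundC (ιSU N) U.1) (pairOfRecord F M k X)).re = 0
  rw [functionalC_runTowers_toClusterTower_eq_zero G hG]
  simp

end TermlessReading

/-! ## §2 N18's literal at a bundle with vanishing level functionals (the N18 twin of 9‴c §4 ∕ 9″c §4 «INHABITATION IS NOT CONTENT») -/

section N18Zero

variable {F : T4Family} (θ : Stage13Params F N) (u : Node00.U3Objects₁₁) (k : ℕ)

/-- **`N18At` AT THE STAGE-13 BUNDLE OF U3 OBJECTS WHOSE LEVEL-`k` FUNCTIONALS VANISH**, under the two signs `0 ≤ u.C₅`, `0 ≤ u.θ₅`: NE5's left side is `|0 − 0|`, its right side is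
nonnegative.  No estimate. [folklore] -/
theorem n18At_u3OfRecord₁₃_of_EA_EB_zero (hC₅ : 0 ≤ u.C₅) (hθ₅ : 0 ≤ u.θ₅)
    (hA : ∀ (g : ℕ → ℝ) (U : (u.levelCarriers k).BgA) (X : (u.levelCarriers k).Dom), u.EA k g U X = 0)
    (hB : ∀ (b : ℝ) (g : ℕ → ℝ) (U : (u.levelCarriers k).BgB) (X : (u.levelCarriers k).Dom), u.EB k b g U X = 0) :
    N18At (u3OfRecord₁₃ θ u k) := by
  intro b _ _ g _ U X
  show |u.EA k g ((u.levelCarriers k).transport U) X - u.EB k b g U X| ≤ u.C₅ * u.θ₅ ^ (u.levelCarriers k).scale X * Real.exp (-(u.κ * (u.levelCarriers k).d X))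
  rw [hA, hB, sub_zero, abs_zero]
  exact mul_nonneg (mul_nonneg hC₅ (pow_nonneg hθ₅ _)) (Real.exp_nonneg _)

end N18Zero

/-! ## §3 θ-LEVEL JOINT WITNESSES: the FULL binder list of each θ-form knit lemma is inhabited at EVERY Stage-13 tuple (edition-free: the ₁₃ ∕ Sep ∕ Co ∕ CoP ∕ CoPR ∕ CoPH
stub-level knits are these lemmas applied pointwise) -/

section ThetaWitnesses

variable {F : T4Family} (θ : Stage13Params F N)

/-- **A6 WITNESS FOR 8c‴ §1 `n22At_u3OfRecord₁₃_ofRecordAdm_gen_of_n18Below_schemasBelow`** (hence for 8c″ in every Record-13 edition — `…13`, `…13Sep`, `…13Co`, `…13CoP`,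
`…13CoPR`, `…13CoPH` — whose eight theorems are this lemma pointwise): at EVERY Stage-13 tuple `θ` there are a generator family `G`, a space table `sp`, a gauge, a transport
with its preservation clause and letter inputs `li` such that AT EVERY RUN LENGTH `k` the lemma's three binders hold TOGETHER — `h18` (indeed `N18At` at EVERY run length, not
only below `k`), the sharp schema package `hsch` (a conj-symmetric open `Dk ⊇` the closed `li.r`-discs about `]0, θ.γ]`, admissible classes, (A-last)ₘ, (A-prop)ₘ, the complex
sup letter) and the eleven numerals `hnum`.  Witness: §1's termless generators, `sp := univ`, gauge `0`, transport to the trivial field, `Dk := univ`, `Adm := univ`, §1's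
letters.  (The lemma's last binder `0 < θ.γ` is a property of the tuple — at a datum of record it is `IsDatumOfRecord₁₃C….gamma_pos` — not of the objects.)
INHABITATION IS NOT CONTENT. [folklore] -/
theorem ofRecordAdm_gen_schemasBelow_binders_inhabited :
    ∃ (G : (k : ℕ) → GenTower (F.P k) (MatA N) θ.τ9.M)
      (sp : (k j : ℕ) → (domSys (F.P k) θ.τ9.M j).Dom → Set (CPair (F.P k) (MatA N)))
      (gauge : (k : ℕ) → GaugeField (F.P k) 0 (Node00.SU N) → GaugeField (F.P k) 0 (Node00.SU N) → ℝ) (hg : ∀ k U U', 0 ≤ gauge k U U')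
      (T₀ : (k : ℕ) → GaugeField (F.P (k + 1)) 0 (Node00.SU N) → GaugeField (F.P k) 0 (Node00.SU N))
      (hT₀ : ∀ (k : ℕ) (U : GaugeField (F.P (k + 1)) 0 (Node00.SU N)),
        (∀ (j : ℕ) (Y : (domSys (F.P (k + 1)) θ.τ9.M j).Dom), ofBackgroundC (ιSU N) U ∈ sp (k + 1) j Y) →
        ∀ (j : ℕ) (Y : (domSys (F.P k) θ.τ9.M j).Dom), ofBackgroundC (ιSU N) (T₀ k U) ∈ sp k j Y)
      (li : LetterInputs),
      ∀ k : ℕ,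
        (∀ k' : ℕ, N18At (u3OfRecord₁₃ θ
          ((ReadingData.ofRecordAdm F θ.τ9.M N (runTowers fun k => toClusterTower (G k)) sp gauge hg T₀ hT₀ li).u3Objects θ.γ) k')) ∧
        (∃ (Dk : Set ℂ) (Adm : (m : ℕ) → Set (OlderTerms (F.P k) (MatA N) θ.τ9.M m)),
          IsOpen Dk ∧ (∀ z ∈ Dk, conj z ∈ Dk) ∧ (∀ t ∈ Ioc (0 : ℝ) θ.γ, closedBall (t : ℂ) li.r ⊆ Dk) ∧
          (∀ g : ℕ → ℂ, (∀ n, g n ∈ Dk) → ∀ m < k, olderOf (recTerm (G k) g) m ∈ Adm m) ∧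
          (∀ m < k, (G k m).AnalyticInLast Dk (Adm m) (sp k (m + 1))) ∧
          (∀ m < k, (G k m).PropagatesAnalyticity Dk (Adm m) (fun j : Fin (m + 1) => sp k j) (sp k (m + 1))) ∧
          (∀ g ∈ Window θ.γ, ∀ (i j : ℕ), i < j → j ≤ k → ∀ (X : (domSys (F.P k) θ.τ9.M j).Dom), ∀ φ ∈ sp k j X, ∀ z ∈ Dk,
            ‖recTerm (G k) (Function.update (fun n => ((g n : ℝ) : ℂ)) i z) j X φ‖ ≤
              li.A * li.μ ^ (j - 1 - i) * Real.exp (-(li.κ * (domSys (F.P k) θ.τ9.M j).dj X)))) ∧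
        (0 < li.C₀ ∧ 0 < li.θ₅ ∧ li.θ₅ < 1 ∧ 0 ≤ li.C₅ ∧ 2 * li.C₅ / (1 - li.θ₅) ≤ li.C₀ ∧ 0 < li.A ∧ li.θ₅ ≤ li.μ ∧
          li.C₀ ≤ 2 * li.A ∧ 0 < li.r ∧ 0 < li.s ∧ li.s < 1) := by
  have hex := fun k => exists_genTower_recTerm_eq_zero (F.P k) (MatA N) θ.τ9.M
  choose G hE hG using hex
  obtain ⟨li, hnum, -⟩ := exists_letterInputs_numerals_signs one_pos
  refine ⟨G, fun _ _ _ => univ, fun _ _ _ => 0, fun _ _ _ => le_rfl, fun _ _ => fun _ => 1, fun _ _ _ _ _ => mem_univ _, li, fun k => ⟨?_, ?_, hnum⟩⟩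
  · intro k'
    exact n18At_u3OfRecord₁₃_of_EA_EB_zero θ _ k' hnum.2.2.2.1 hnum.2.1.le
      (fun g U X => u3Objects_ofRecordAdm_EA_eq_zero_of_recTerm G (fun _ _ _ => univ) (fun _ _ _ => 0) (fun _ _ _ => le_rfl) (fun _ _ => fun _ => 1)
        (fun _ _ _ _ _ => mem_univ _) li θ.γ hG k' g U X)
      (fun b g U X => u3Objects_ofRecordAdm_EB_eq_zero_of_recTerm G (fun _ _ _ => univ) (fun _ _ _ => 0) (fun _ _ _ => le_rfl) (fun _ _ => fun _ => 1)
        (fun _ _ _ _ _ => mem_univ _) li θ.γ hG k' b g U X)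
  · refine ⟨univ, fun _ => univ, isOpen_univ, fun z _ => mem_univ _, fun t _ => subset_univ _, fun g _ m _ => mem_univ _,
      fun m _ old _ X φ _ => ?_, fun m _ c _ _ t _ X φ _ => ?_, fun g _ i j _ _ X φ _ z _ => ?_⟩
    · have : (fun t : ℂ => (G k m).E t old φ X) = fun _ => 0 := funext fun t => hE k m t old φ X
      rw [this]
      exact analyticOnNhd_const
    · have : (fun s : ℂ => (G k m).E t (c s) φ X) = fun _ => 0 := funext fun s => hE k m t (c s) φ X
      rw [this]
      exact analyticOnNhd_const
    · rw [hG, norm_zero]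
      exact mul_nonneg (mul_nonneg hnum.2.2.2.2.2.1.le (pow_nonneg (hnum.2.1.le.trans hnum.2.2.2.2.2.2.1) _)) (Real.exp_nonneg _)

/-- **A6 WITNESS FOR 8a‴ §1 `n22At_u3OfRecord₁₃_ofRecordAdm_of_n18Below_analytic`** (hence 8a″ in every Record-13 edition): at EVERY Stage-13 tuple there are towers `S`,
tables, gauge, transport and letters for which, at EVERY run length `k`, `N18At` holds at every run length, the pin (J) «no term after the run» holds (indeed NO term at all),
the analytic letter (A) holds per admissible background (extension `Fz := 0` on `Dset := univ`), and the eleven numerals hold.  Witness: the run towers of §1's termless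
generators.  INHABITATION IS NOT CONTENT. [folklore] -/
theorem ofRecordAdm_analytic_binders_inhabited :
    ∃ (S : (k : ℕ) → ClusterTower (F.P k) (MatA N) θ.τ9.M)
      (sp : (k j : ℕ) → (domSys (F.P k) θ.τ9.M j).Dom → Set (CPair (F.P k) (MatA N)))
      (gauge : (k : ℕ) → GaugeField (F.P k) 0 (Node00.SU N) → GaugeField (F.P k) 0 (Node00.SU N) → ℝ) (hg : ∀ k U U', 0 ≤ gauge k U U')
      (T₀ : (k : ℕ) → GaugeField (F.P (k + 1)) 0 (Node00.SU N) → GaugeField (F.P k) 0 (Node00.SU N))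
      (hT₀ : ∀ (k : ℕ) (U : GaugeField (F.P (k + 1)) 0 (Node00.SU N)),
        (∀ (j : ℕ) (Y : (domSys (F.P (k + 1)) θ.τ9.M j).Dom), ofBackgroundC (ιSU N) U ∈ sp (k + 1) j Y) →
        ∀ (j : ℕ) (Y : (domSys (F.P k) θ.τ9.M j).Dom), ofBackgroundC (ιSU N) (T₀ k U) ∈ sp k j Y)
      (li : LetterInputs),
      ∀ k : ℕ,
        (∀ k' : ℕ, N18At (u3OfRecord₁₃ θ ((ReadingData.ofRecordAdm F θ.τ9.M N S sp gauge hg T₀ hT₀ li).u3Objects θ.γ) k')) ∧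
        (∀ (k : ℕ) (X : Node00.W1.Dom (F.P k) θ.τ9.M), k < X.1 → ∀ (g : ℕ → ℝ) (φ : CPair (F.P k) (MatA N)), functionalC (S k) g φ X = 0) ∧
        (∀ g ∈ Window θ.γ, ∀ (U : AdmBg F θ.τ9.M N sp k) (X : Node00.W1.Dom (F.P k) θ.τ9.M) (i : ℕ), i < X.1 →
          ∃ (Fz : ℂ → ℂ) (Dset : Set ℂ), DifferentiableOn ℂ Fz Dset ∧
            (∀ z ∈ Dset, ‖Fz z‖ ≤ li.A * li.μ ^ (X.1 - 1 - i) * Real.exp (-(li.κ * (domSys (F.P k) θ.τ9.M X.1).dj X.2))) ∧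
            (∀ t ∈ Ioc (0 : ℝ) θ.γ, closedBall (t : ℂ) li.r ⊆ Dset) ∧
            (∀ t ∈ Ioc (0 : ℝ) θ.γ, Fz t = ((functionalC (S k) (Function.update g i t) (ofBackgroundC (ιSU N) U.1) X).re : ℂ))) ∧
        (0 < li.C₀ ∧ 0 < li.θ₅ ∧ li.θ₅ < 1 ∧ 0 ≤ li.C₅ ∧ 2 * li.C₅ / (1 - li.θ₅) ≤ li.C₀ ∧ 0 < li.A ∧ li.θ₅ ≤ li.μ ∧
          li.C₀ ≤ 2 * li.A ∧ 0 < li.r ∧ 0 < li.s ∧ li.s < 1) := by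
  have hex := fun k => exists_genTower_recTerm_eq_zero (F.P k) (MatA N) θ.τ9.M
  choose G _ hG using hex
  obtain ⟨li, hnum, -⟩ := exists_letterInputs_numerals_signs one_pos
  refine ⟨runTowers fun k => toClusterTower (G k), fun _ _ _ => univ, fun _ _ _ => 0, fun _ _ _ => le_rfl, fun _ _ => fun _ => 1, fun _ _ _ _ _ => mem_univ _, li,
    fun k => ⟨fun k' => ?_, fun k X _ g φ => functionalC_runTowers_toClusterTower_eq_zero G hG k g φ X, fun g _ U X i _ => ?_, hnum⟩⟩
  · exact n18At_u3OfRecord₁₃_of_EA_EB_zero θ _ k' hnum.2.2.2.1 hnum.2.1.le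
      (fun g U X => u3Objects_ofRecordAdm_EA_eq_zero_of_recTerm G (fun _ _ _ => univ) (fun _ _ _ => 0) (fun _ _ _ => le_rfl) (fun _ _ => fun _ => 1)
        (fun _ _ _ _ _ => mem_univ _) li θ.γ hG k' g U X)
      (fun b g U X => u3Objects_ofRecordAdm_EB_eq_zero_of_recTerm G (fun _ _ _ => univ) (fun _ _ _ => 0) (fun _ _ _ => le_rfl) (fun _ _ => fun _ => 1)
        (fun _ _ _ _ _ => mem_univ _) li θ.γ hG k' b g U X)
  · refine ⟨fun _ => 0, univ, differentiableOn_const 0, fun z _ => ?_, fun t _ => subset_univ _, fun t _ => ?_⟩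
    · rw [norm_zero]
      exact mul_nonneg (mul_nonneg hnum.2.2.2.2.2.1.le (pow_nonneg (hnum.2.1.le.trans hnum.2.2.2.2.2.2.1) _)) (Real.exp_nonneg _)
    · rw [functionalC_runTowers_toClusterTower_eq_zero G hG]
      simp

/-- **A6 WITNESS FOR 7‴ §2 `n22At_u3OfRecord₁₃_w1_of_n18Below_analytic`** (the edge at a GENERAL W1 reading datum `D`; hence 7″ in every Record-13 edition): at EVERY Stage-13
tuple there is a reading datum `D` carrying dag-n22-c's pairing coherence (C1)(C2) (surjectivity above step `0`, background lift) — BY NAME, `pairingCoherence_ofRecordAdm` —,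
junk-freeness (J), the eleven numerals, and at EVERY run length `N18At` and the analytic letter (A).  Witness: the admissible reading of record on the run towers of §1's
termless generators.  INHABITATION IS NOT CONTENT. [folklore] -/
theorem w1_analytic_binders_inhabited :
    ∃ D : ReadingData F (MatA N) θ.τ9.M,
      (∀ (k : ℕ) (X₁ : Node00.W1.Dom (F.P k) θ.τ9.M), ((D.pairing k).pair X₁).1 = X₁.1 + 1) ∧
      (∀ (k : ℕ) (X₁ : Node00.W1.Dom (F.P k) θ.τ9.M),
        (domSys (F.P (k + 1)) θ.τ9.M ((D.pairing k).pair X₁).1).dj ((D.pairing k).pair X₁).2 = (domSys (F.P k) θ.τ9.M X₁.1).dj X₁.2) ∧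
      (∀ (k : ℕ) (X : Node00.W1.Dom (F.P (k + 1)) θ.τ9.M), 1 ≤ X.1 → ∃ X₁ : Node00.W1.Dom (F.P k) θ.τ9.M, (D.pairing k).pair X₁ = X) ∧
      (∀ (k : ℕ) (U : (D.pairing (k + 1)).BgA), ∃ U₁ : (D.pairing k).BgB, (D.pairing k).embB U₁ = (D.pairing (k + 1)).embA U) ∧
      (∀ (k : ℕ) (g : ℕ → ℝ) (U : (D.pairing k).BgA) (X : Node00.W1.Dom (F.P k) θ.τ9.M), k < X.1 → (D.pairing k).EA (D.S k) g U X = 0) ∧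
      (0 < D.li.C₀ ∧ 0 < D.li.θ₅ ∧ D.li.θ₅ < 1 ∧ 0 ≤ D.li.C₅ ∧ 2 * D.li.C₅ / (1 - D.li.θ₅) ≤ D.li.C₀ ∧ 0 < D.li.A ∧ D.li.θ₅ ≤ D.li.μ ∧
        D.li.C₀ ≤ 2 * D.li.A ∧ 0 < D.li.r ∧ 0 < D.li.s ∧ D.li.s < 1) ∧
      ∀ k : ℕ,
        (∀ k' : ℕ, N18At (u3OfRecord₁₃ θ (D.u3Objects θ.γ) k')) ∧
        (∀ g ∈ Window θ.γ, ∀ (U : ((D.u3Objects θ.γ).levelCarriers k).BgA) (X : ((D.u3Objects θ.γ).levelCarriers k).Dom) (i : ℕ),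
          i < ((D.u3Objects θ.γ).levelCarriers k).scale X → ∃ (Fz : ℂ → ℂ) (Dset : Set ℂ), DifferentiableOn ℂ Fz Dset ∧
            (∀ z ∈ Dset, ‖Fz z‖ ≤ D.li.A * D.li.μ ^ (((D.u3Objects θ.γ).levelCarriers k).scale X - 1 - i) *
              Real.exp (-((D.u3Objects θ.γ).κ * ((D.u3Objects θ.γ).levelCarriers k).d X))) ∧
            (∀ t ∈ Ioc (0 : ℝ) θ.γ, closedBall (t : ℂ) D.li.r ⊆ Dset) ∧
            (∀ t ∈ Ioc (0 : ℝ) θ.γ, Fz t = ((D.u3Objects θ.γ).EA k (Function.update g i t) U X : ℂ))) := by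
  have hex := fun k => exists_genTower_recTerm_eq_zero (F.P k) (MatA N) θ.τ9.M
  choose G _ hG using hex
  obtain ⟨li, hnum, -⟩ := exists_letterInputs_numerals_signs one_pos
  obtain ⟨hfst, hdj, hsurj, hbg⟩ := YMDAG.N22.W1.pairingCoherence_ofRecordAdm (N := N) (runTowers fun k => toClusterTower (G k)) (fun _ _ _ => univ) (fun _ _ _ => (0 : ℝ))
    (fun _ _ _ => le_rfl) (fun _ _ => fun _ => 1) (fun _ _ _ _ _ => mem_univ _) li (M := θ.τ9.M)
  have hA := u3Objects_ofRecordAdm_EA_eq_zero_of_recTerm G (fun _ _ _ => univ) (fun _ _ _ => 0) (fun _ _ _ => le_rfl) (fun _ _ => fun _ => 1)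
    (fun _ _ _ _ _ => mem_univ _) li θ.γ hG
  have hB := u3Objects_ofRecordAdm_EB_eq_zero_of_recTerm G (fun _ _ _ => univ) (fun _ _ _ => 0) (fun _ _ _ => le_rfl) (fun _ _ => fun _ => 1)
    (fun _ _ _ _ _ => mem_univ _) li θ.γ hG
  refine ⟨ReadingData.ofRecordAdm F θ.τ9.M N (runTowers fun k => toClusterTower (G k)) (fun _ _ _ => univ) (fun _ _ _ => 0) (fun _ _ _ => le_rfl)
      (fun _ _ => fun _ => 1) (fun _ _ _ _ _ => mem_univ _) li, hfst, hdj, hsurj, hbg, fun k g U X _ => hA k g U X, hnum, fun k => ⟨fun k' => ?_, fun g _ U X i _ => ?_⟩⟩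
  · exact n18At_u3OfRecord₁₃_of_EA_EB_zero θ _ k' hnum.2.2.2.1 hnum.2.1.le (hA k') (hB k')
  · refine ⟨fun _ => 0, univ, differentiableOn_const 0, fun z _ => ?_, fun t _ => subset_univ _, fun t _ => ?_⟩
    · rw [norm_zero]
      exact mul_nonneg (mul_nonneg hnum.2.2.2.2.2.1.le (pow_nonneg (hnum.2.1.le.trans hnum.2.2.2.2.2.2.1) _)) (Real.exp_nonneg _)
    · rw [hA]
      simp

end ThetaWitnesses

end YMDAG.N22

end
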